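import Mathlib
import Literature.MathematicalPhysics.StatisticalMechanics.Crystallization
import Summits.AtomisticToContinuum.Crystallization.Theorems.BraggSlacknessRigidityHcpDiffractionRigidityDenseCentresAux2

/-!
# A Gaussian-quiet set is infinite (helper toward the research kernel of crux
# `HcpDiffractionRigidity`, item `stmt-AtomisticToContinuum-13166`)

If a non-empty `Λ ⊆ ℝ³` is Gaussian-quiet along scales `L t → ∞` off the Bragg set of a periodic
template (the quietness hypothesis of the rigidity stubs), then `Λ` is infinite: for finite `Λ`
the windowed structure factor converges to the trigonometric polynomial
`P(ξ) = Σ_{s ∈ Λ} e^{2πi⟨ξ,s⟩}` with `P(0) = #Λ`, bounded below near `0`, while small non-zero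
frequencies below the first Bragg radius are admissible.  (So quietness is not vacuous: finite
template-exact clusters such as the equilateral triangle of side `√(a²/3 + h²)`, which are not
lattice-confined, are excluded by it.)  Harvested from the worker analysis of
`stub_layeredConfinementIrrat` (lead c4).

All `[folklore]`.
-/

noncomputable section

namespace Summit.AtomisticToContinuum.Crystallization.Theorems

namespace HcpRigidityQuiet

open MeasureTheory Complex Filter Metric Set
open scoped BigOperators Real RealInnerProductSpace Topology
open Literature.MathematicalPhysics.StatisticalMechanics
open Summit.AtomisticToContinuum.Crystallization.Theorems.HcpRigidityDenseCentres

/-- The phase `e^{2πi⟨ξ,s⟩}` has modulus one. [folklore] -/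
theorem norm_phase (ξ s : (EuclideanSpace ℝ (Fin 3))) : ‖Complex.exp (2 * Real.pi * Complex.I * (⟪ξ, s⟫ : ℂ))‖ = 1 := by
  rw [show (2 * Real.pi * Complex.I * (⟪ξ, s⟫ : ℂ)) = ((2 * Real.pi * ⟪ξ, s⟫ : ℝ) : ℂ) * Complex.I
    by push_cast; ring, Complex.norm_exp_ofReal_mul_I]

/-- The phase `ξ ↦ e^{2πi⟨ξ,s⟩}` is continuous. [folklore] -/
theorem continuous_phase (s : (EuclideanSpace ℝ (Fin 3))) :
    Continuous fun ξ : (EuclideanSpace ℝ (Fin 3)) => Complex.exp (2 * Real.pi * Complex.I * (⟪ξ, s⟫ : ℂ)) :=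
  Complex.continuous_exp.comp (continuous_const.mul
    (Complex.continuous_ofReal.comp (continuous_id.inner continuous_const)))

/-- **A Gaussian-quiet set is infinite.** If `Λ ≠ ∅` is Gaussian-quiet along scales `L t → ∞`
off the Bragg set of a periodic template (the quietness hypothesis of the rigidity stubs), then
`Λ` is infinite: for finite `Λ` the windowed structure factor converges to the trigonometric
polynomial `P(ξ) = Σ_{s ∈ Λ} e^{2πi⟨ξ,s⟩}` with `P(0) = #Λ`, which is bounded below near `0`,
while small non-zero frequencies below the first Bragg radius are admissible. [folklore] -/
theorem infinite_of_quiet (P : PeriodicConfiguration 3) {Λ : Set (EuclideanSpace ℝ (Fin 3))} (hne : Λ.Nonempty)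
    (hQ : ∃ L : ℕ → ℝ, Tendsto L atTop atTop ∧ ∀ g : (EuclideanSpace ℝ (Fin 3)) → ℝ, Continuous g → HasCompactSupport g →
      (∀ ξ ∈ tsupport g, ξ ≠ 0 ∧ ∀ k : (EuclideanSpace ℝ (Fin 3)), (∀ v ∈ P.lattice, ∃ n : ℤ, ⟪k, v⟫ = (n : ℝ)) →
        ‖ξ‖ ≠ ‖k‖) → ∀ ε : ℝ, 0 < ε → ∀ᶠ t : ℕ in atTop,
        (∫ ξ : (EuclideanSpace ℝ (Fin 3)), g ξ * ‖∑' s : Λ, (Real.exp (-(‖(s : (EuclideanSpace ℝ (Fin 3)))‖ ^ 2) / L t ^ 2) : ℂ) *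
          Complex.exp (2 * Real.pi * Complex.I * (⟪ξ, (s : (EuclideanSpace ℝ (Fin 3)))⟫ : ℂ))‖ ^ 2) ≤
        ε * ∑' s : Λ, Real.exp (-(‖(s : (EuclideanSpace ℝ (Fin 3)))‖ ^ 2) / L t ^ 2) ^ 2) :
    Λ.Infinite := by
  intro hfin
  haveI : Fintype Λ := hfin.fintype
  obtain ⟨L, hL, hq⟩ := hQ
  simp_rw [tsum_fintype] at hq
  -- the limiting trigonometric polynomial
  set Pf : (EuclideanSpace ℝ (Fin 3)) → ℂ := fun ξ => ∑ s : Λ, Complex.exp (2 * Real.pi * Complex.I * (⟪ξ, (s : (EuclideanSpace ℝ (Fin 3)))⟫ : ℂ))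
    with hPf
  have hcard : (0 : ℝ) < Fintype.card Λ := by
    haveI : Nonempty Λ := hne.to_subtype
    exact_mod_cast Fintype.card_pos
  have hcard1 : (1 : ℝ) ≤ Fintype.card Λ := by
    haveI : Nonempty Λ := hne.to_subtype
    exact_mod_cast Fintype.card_pos
  have hP0 : Pf 0 = (Fintype.card Λ : ℂ) := by
    simp [hPf]
  have hPcont : Continuous Pf := by
    rw [hPf]
    exact continuous_finsetSum _ fun s _ => continuous_phase (s : (EuclideanSpace ℝ (Fin 3)))
  -- `‖Pf ξ‖ ≥ 1/2` near `0`
  obtain ⟨ρ, hρ, hρP⟩ := Metric.continuousAt_iff.1 hPcont.continuousAt (1 / 2) (by norm_num)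
  have hPlow : ∀ ξ : (EuclideanSpace ℝ (Fin 3)), ‖ξ‖ < ρ → 1 / 2 ≤ ‖Pf ξ‖ := by
    intro ξ hξ
    have h1 : dist (Pf ξ) (Pf 0) < 1 / 2 := hρP (by rwa [dist_zero_right])
    rw [dist_eq_norm, hP0] at h1
    have h2 : ‖(Fintype.card Λ : ℂ)‖ = Fintype.card Λ := by simp
    have h3 := norm_sub_norm_le (Fintype.card Λ : ℂ) (Pf ξ)
    rw [← norm_neg, neg_sub] at h1
    linarith
  -- the first Bragg radius and the test frequency
  obtain ⟨r, hr, hdual⟩ := exists_pos_le_norm_of_dual P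
  set c : ℝ := min ρ r / 2 with hc
  have hc0 : 0 < c := by positivity
  have hcρ : c ≤ ρ / 2 := by rw [hc]; linarith [min_le_left ρ r]
  have hcr : c ≤ r / 2 := by rw [hc]; linarith [min_le_right ρ r]
  set ξ₀ : (EuclideanSpace ℝ (Fin 3)) := c • EuclideanSpace.single (0 : Fin 3) (1 : ℝ) with hξ₀
  have hξ₀n : ‖ξ₀‖ = c := by
    rw [hξ₀, norm_smul, PiLp.norm_single, norm_one, mul_one, Real.norm_eq_abs, abs_of_pos hc0]
  -- the bump test function
  let g : ContDiffBump ξ₀ := ⟨c / 4, c / 2, by positivity, by linarith⟩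
  have hgsupp : ∀ ξ : (EuclideanSpace ℝ (Fin 3)), (g : (EuclideanSpace ℝ (Fin 3)) → ℝ) ξ ≠ 0 → ‖ξ‖ < 2 * c ∧ c / 2 < ‖ξ‖ := by
    intro ξ hξ
    have hmem : ξ ∈ Function.support (g : (EuclideanSpace ℝ (Fin 3)) → ℝ) := hξ
    rw [g.support_eq, mem_ball, dist_eq_norm] at hmem
    have h1 := norm_sub_norm_le ξ ξ₀
    have h2 := norm_sub_norm_le ξ₀ ξ
    rw [norm_sub_rev] at h2
    rw [hξ₀n] at h1 h2
    have hout : g.rOut = c / 2 := rfl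
    rw [hout] at hmem
    constructor <;> linarith
  have hgadm : ∀ ξ ∈ tsupport (g : (EuclideanSpace ℝ (Fin 3)) → ℝ), ξ ≠ 0 ∧ ∀ k : (EuclideanSpace ℝ (Fin 3)),
      (∀ v ∈ P.lattice, ∃ n : ℤ, ⟪k, v⟫ = (n : ℝ)) → ‖ξ‖ ≠ ‖k‖ := by
    intro ξ hξ
    rw [g.tsupport_eq, mem_closedBall, dist_eq_norm] at hξ
    have hout : g.rOut = c / 2 := rfl
    rw [hout] at hξ
    have h1 := norm_sub_norm_le ξ₀ ξ
    rw [norm_sub_rev, hξ₀n] at h1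
    have h2 := norm_sub_norm_le ξ ξ₀
    rw [hξ₀n] at h2
    have hξpos : c / 2 ≤ ‖ξ‖ := by linarith
    have hξlt : ‖ξ‖ < r := by linarith
    refine ⟨fun h0 => ?_, fun k hk => ?_⟩
    · rw [h0, norm_zero] at hξpos; linarith
    · by_cases hk0 : k = 0
      · rw [hk0, norm_zero]; intro h; rw [h] at hξpos; linarith
      · have := hdual k hk hk0
        intro h; rw [h] at hξlt; linarith
  -- the limit integral `B = ∫ g |P|²` and its lower bound
  set B : ℝ := ∫ ξ : (EuclideanSpace ℝ (Fin 3)), (g : (EuclideanSpace ℝ (Fin 3)) → ℝ) ξ * ‖Pf ξ‖ ^ 2 with hB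
  have hgi : Integrable (fun ξ : (EuclideanSpace ℝ (Fin 3)) => (1 / 4) * (g : (EuclideanSpace ℝ (Fin 3)) → ℝ) ξ) :=
    (continuous_const.mul g.continuous).integrable_of_hasCompactSupport
      g.hasCompactSupport.mul_left
  have hBi : Integrable (fun ξ : (EuclideanSpace ℝ (Fin 3)) => (g : (EuclideanSpace ℝ (Fin 3)) → ℝ) ξ * ‖Pf ξ‖ ^ 2) :=
    (g.continuous.mul ((hPcont.norm).pow 2)).integrable_of_hasCompactSupport
      g.hasCompactSupport.mul_right
  have hBlow : (1 / 4) * ∫ ξ : (EuclideanSpace ℝ (Fin 3)), (g : (EuclideanSpace ℝ (Fin 3)) → ℝ) ξ ≤ B := by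
    rw [hB, ← integral_const_mul]
    refine integral_mono hgi hBi fun ξ => ?_
    by_cases hξ : (g : (EuclideanSpace ℝ (Fin 3)) → ℝ) ξ = 0
    · simp only [hξ, zero_mul, mul_zero, le_refl]
    · have h1 := (hgsupp ξ hξ).1
      have h2 : 1 / 2 ≤ ‖Pf ξ‖ := hPlow ξ (by linarith)
      have h3 : (1 / 4 : ℝ) ≤ ‖Pf ξ‖ ^ 2 := by nlinarith
      rw [mul_comm]
      exact mul_le_mul_of_nonneg_left h3 g.nonneg
  have hBpos : 0 < B := lt_of_lt_of_le (by have := g.integral_pos (μ := volume); positivity) hBlow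
  -- quietness at level `ε = B / (2 #Λ)`
  set ε : ℝ := B / (2 * Fintype.card Λ) with hε
  have hεpos : 0 < ε := by positivity
  have hev := hq g g.continuous g.hasCompactSupport hgadm ε hεpos
  -- the windowed intensities converge to `B`
  set w : ℕ → (EuclideanSpace ℝ (Fin 3)) → ℝ := fun t s => Real.exp (-(‖s‖ ^ 2) / L t ^ 2) with hw
  have hw1 : ∀ t s, w t s ≤ 1 := fun t s => by
    rw [hw]
    exact Real.exp_le_one_iff.2 (div_nonpos_of_nonpos_of_nonneg (neg_nonpos.2 (sq_nonneg _))
      (sq_nonneg _))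
  have hw0 : ∀ t s, 0 ≤ w t s := fun t s => (Real.exp_pos _).le
  have hwlim : ∀ s : (EuclideanSpace ℝ (Fin 3)), Tendsto (fun t => w t s) atTop (𝓝 1) := by
    intro s
    have h1 : Tendsto (fun t => -(‖s‖ ^ 2) / L t ^ 2) atTop (𝓝 0) :=
      tendsto_const_nhds.div_atTop ((tendsto_pow_atTop two_ne_zero).comp hL)
    have h2 := (Real.continuous_exp.tendsto 0).comp h1
    rwa [Real.exp_zero] at h2
  set F : ℕ → (EuclideanSpace ℝ (Fin 3)) → ℝ := fun t ξ => (g : (EuclideanSpace ℝ (Fin 3)) → ℝ) ξ * ‖∑ s : Λ, (w t (s : (EuclideanSpace ℝ (Fin 3))) : ℂ) *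
    Complex.exp (2 * Real.pi * Complex.I * (⟪ξ, (s : (EuclideanSpace ℝ (Fin 3)))⟫ : ℂ))‖ ^ 2 with hF
  have hSnorm : ∀ t ξ, ‖∑ s : Λ, (w t (s : (EuclideanSpace ℝ (Fin 3))) : ℂ) *
      Complex.exp (2 * Real.pi * Complex.I * (⟪ξ, (s : (EuclideanSpace ℝ (Fin 3)))⟫ : ℂ))‖ ≤ Fintype.card Λ := by
    intro t ξ
    calc _ ≤ ∑ s : Λ, ‖(w t (s : (EuclideanSpace ℝ (Fin 3))) : ℂ) * Complex.exp (2 * Real.pi * Complex.I * (⟪ξ, (s : (EuclideanSpace ℝ (Fin 3)))⟫ : ℂ))‖ :=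
          norm_sum_le _ _
      _ ≤ ∑ _s : Λ, (1 : ℝ) := Finset.sum_le_sum fun s _ => by
          rw [norm_mul, norm_phase, mul_one, Complex.norm_real, Real.norm_eq_abs,
            abs_of_nonneg (hw0 _ _)]
          exact hw1 _ _
      _ = Fintype.card Λ := by simp
  have hFmeas : ∀ t, AEStronglyMeasurable (F t) volume := by
    intro t
    refine (g.continuous.mul ((Continuous.norm ?_).pow 2)).aestronglyMeasurable
    exact continuous_finsetSum _ fun s _ => continuous_const.mul (continuous_phase (s : (EuclideanSpace ℝ (Fin 3))))
  have hFbound : ∀ t, ∀ᵐ ξ ∂(volume : Measure (EuclideanSpace ℝ (Fin 3))), ‖F t ξ‖ ≤ (g : (EuclideanSpace ℝ (Fin 3)) → ℝ) ξ * (Fintype.card Λ) ^ 2 := by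
    intro t
    refine ae_of_all _ fun ξ => ?_
    rw [hF]
    dsimp only
    rw [Real.norm_eq_abs, abs_of_nonneg (mul_nonneg g.nonneg (sq_nonneg _))]
    exact mul_le_mul_of_nonneg_left (pow_le_pow_left₀ (norm_nonneg _) (hSnorm t ξ) 2) g.nonneg
  have hbi : Integrable (fun ξ : (EuclideanSpace ℝ (Fin 3)) => (g : (EuclideanSpace ℝ (Fin 3)) → ℝ) ξ * (Fintype.card Λ : ℝ) ^ 2) :=
    (g.continuous.mul continuous_const).integrable_of_hasCompactSupport
      g.hasCompactSupport.mul_right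
  have hFlim : ∀ᵐ ξ ∂(volume : Measure (EuclideanSpace ℝ (Fin 3))), Tendsto (fun t => F t ξ) atTop
      (𝓝 ((g : (EuclideanSpace ℝ (Fin 3)) → ℝ) ξ * ‖Pf ξ‖ ^ 2)) := by
    refine ae_of_all _ fun ξ => ?_
    have h1 : Tendsto (fun t => ∑ s : Λ, (w t (s : (EuclideanSpace ℝ (Fin 3))) : ℂ) *
        Complex.exp (2 * Real.pi * Complex.I * (⟪ξ, (s : (EuclideanSpace ℝ (Fin 3)))⟫ : ℂ))) atTop (𝓝 (Pf ξ)) := by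
      rw [hPf]
      refine tendsto_finsetSum _ fun s _ => ?_
      have h2 : Tendsto (fun t => (w t (s : (EuclideanSpace ℝ (Fin 3))) : ℂ)) atTop (𝓝 ((1 : ℝ) : ℂ)) :=
        (Complex.continuous_ofReal.tendsto 1).comp (hwlim (s : (EuclideanSpace ℝ (Fin 3))))
      have h3 := h2.mul_const (Complex.exp (2 * Real.pi * Complex.I * (⟪ξ, (s : (EuclideanSpace ℝ (Fin 3)))⟫ : ℂ)))
      simpa using h3
    exact tendsto_const_nhds.mul ((h1.norm).pow 2)
  have hlim : Tendsto (fun t => ∫ ξ : (EuclideanSpace ℝ (Fin 3)), F t ξ) atTop (𝓝 B) :=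
    tendsto_integral_of_dominated_convergence _ hFmeas hbi hFbound hFlim
  -- eventually `∫ F t ≤ ε #Λ = B / 2`
  have hev2 : ∀ᶠ t : ℕ in atTop, ∫ ξ : (EuclideanSpace ℝ (Fin 3)), F t ξ ≤ B / 2 := by
    filter_upwards [hev] with t ht
    have hMG : ∑ s : Λ, Real.exp (-(‖(s : (EuclideanSpace ℝ (Fin 3)))‖ ^ 2) / L t ^ 2) ^ 2 ≤ Fintype.card Λ := by
      calc _ ≤ ∑ _s : Λ, (1 : ℝ) := Finset.sum_le_sum fun s _ => by
            have := hw1 t (s : (EuclideanSpace ℝ (Fin 3))); have := hw0 t (s : (EuclideanSpace ℝ (Fin 3)))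
            rw [hw] at *
            nlinarith
        _ = Fintype.card Λ := by simp
    calc ∫ ξ : (EuclideanSpace ℝ (Fin 3)), F t ξ ≤ ε * ∑ s : Λ, Real.exp (-(‖(s : (EuclideanSpace ℝ (Fin 3)))‖ ^ 2) / L t ^ 2) ^ 2 := ht
      _ ≤ ε * Fintype.card Λ := mul_le_mul_of_nonneg_left hMG hεpos.le
      _ = B / 2 := by rw [hε]; field_simp
  have hle : B ≤ B / 2 := le_of_tendsto hlim hev2
  linarith


end HcpRigidityQuiet

open HcpRigidityQuiet in
/-- **Registered helper stub: a Gaussian-quiet set is infinite.** [folklore] -/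
theorem stub_infiniteOfQuiet : ∀ (P : Literature.MathematicalPhysics.StatisticalMechanics.PeriodicConfiguration 3) (Λ : Set (EuclideanSpace ℝ (Fin 3))), Λ.Nonempty → (∃ L : ℕ → ℝ, Filter.Tendsto L Filter.atTop Filter.atTop ∧ ∀ g : EuclideanSpace ℝ (Fin 3) → ℝ, Continuous g → HasCompactSupport g → (∀ ξ ∈ tsupport g, ξ ≠ 0 ∧ ∀ k : EuclideanSpace ℝ (Fin 3), (∀ v ∈ P.lattice, ∃ n : ℤ, inner ℝ k v = (n : ℝ)) → ‖ξ‖ ≠ ‖k‖) → ∀ ε : ℝ, 0 < ε → ∀ᶠ t : ℕ in Filter.atTop, (∫ ξ, g ξ * ‖∑' s : Λ, (Real.exp (-(‖(s : EuclideanSpace ℝ (Fin 3))‖ ^ 2) / L t ^ 2) : ℂ) * Complex.exp (2 * Real.pi * Complex.I * (inner ℝ ξ (s : EuclideanSpace ℝ (Fin 3)) : ℂ))‖ ^ 2) ≤ ε * ∑' s : Λ, Real.exp (-(‖(s : EuclideanSpace ℝ (Fin 3))‖ ^ 2) / L t ^ 2) ^ 2) → Λ.Infinite :=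
  fun P _ hne hQ => infinite_of_quiet P hne hQ

end Summit.AtomisticToContinuum.Crystallization.Theorems

end
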